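import Literature.Analysis.Distribution.RadialSliceProfiles
import Literature.Analysis.Complex.PolydiscWeightedMeanValue
import HarnessLib

/-!
# The radial kernels `w ↦ β(|w|² − r)` on `ℂ`: mass `π`, support, real slices

Topic `Literature/Analysis/Distribution`; sequel of `RadialSliceProfiles`, input of the weighted
polydisc mean value property (`Literature/Analysis/Complex/PolydiscWeightedMeanValue`) in the
temperedness estimate (4.5) of Osterwalder–Schrader II (Comm. Math. Phys. 42 (1975), Ch. VI.1
(6.4)–(6.7)) with constants of factorial growth. For the order-adapted bump `β = adaptedBump n r`
(mass one, support `[−r, r]`) the radial profile `radialKernel n r t = β(t² − r)` gives the kernel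
`w ↦ β(|w|² − r)` on `ℂ`:

* `radialKernel_eq_zero` — it vanishes for `t ≥ √(2r)`; `continuous_radialKernel`;
* `integral_radialKernel_norm` — **its mass is exactly `π`**: `∫_ℂ β(|w|² − r) dA = π`
  (polar coordinates, `integral_radial_eq`, and the substitution `s = t² − r`);
* `radialKernel_norm_mk` — **its real slices are the slice functions**:
  `β(|x + iy|² − r) = sliceFn n r (y² − r) x`.

## References

* K. Osterwalder, R. Schrader, *Axioms for Euclidean Green's functions II*, Comm. Math. Phys. 42
  (1975) 281–305, Ch. VI.1 (6.4)–(6.7). [OsterwalderSchraderCMP1975]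

Everything here is folklore.
-/

noncomputable section

open Set Metric MeasureTheory Real
open scoped Topology

namespace Literature.Analysis.Distribution

/-- **The radial profile** `t ↦ β(t² − r)`, `β = adaptedBump n r`. [cite: OsterwalderSchraderCMP1975, Ch. VI.1 (6.5)] -/
def radialKernel (n : ℕ) (r : ℝ) (t : ℝ) : ℝ := adaptedBump n r (t ^ 2 - r)

/-- The radial profile is the slice function with parameter `−r`. [folklore] -/
theorem radialKernel_eq_sliceFn (n : ℕ) (r : ℝ) : radialKernel n r = sliceFn n r (-r) := by
  funext t; simp [radialKernel, sliceFn, sub_eq_add_neg]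

/-- The radial profile is continuous. [folklore] -/
theorem continuous_radialKernel (n : ℕ) (r : ℝ) : Continuous (radialKernel n r) := by
  rw [radialKernel_eq_sliceFn]; exact (contDiff_sliceFn n r (-r) (m := 0)).continuous

/-- The radial profile is nonnegative (`r > 0`). [folklore] -/
theorem radialKernel_nonneg (n : ℕ) {r : ℝ} (hr : 0 < r) (t : ℝ) : 0 ≤ radialKernel n r t := adaptedBump_nonneg n hr _

/-- **Support**: the radial profile vanishes for `t ≥ √(2r)`. [folklore] -/
theorem radialKernel_eq_zero (n : ℕ) {r : ℝ} (hr : 0 < r) {t : ℝ} (ht : Real.sqrt (2 * r) ≤ t) : radialKernel n r t = 0 := by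
  by_contra h
  have h2 := sq_le_of_sliceFn_ne_zero n hr (c := -r) (x := t) (by rwa [radialKernel_eq_sliceFn] at h)
  have ht0 : 0 ≤ t := (Real.sqrt_nonneg _).trans ht
  have h3 : 2 * r ≤ t ^ 2 := by
    calc 2 * r = Real.sqrt (2 * r) ^ 2 := by rw [Real.sq_sqrt (by positivity)]
      _ ≤ t ^ 2 := pow_le_pow_left₀ (Real.sqrt_nonneg _) ht 2
  -- `t² ≤ r - (-r) = 2r` and `2r ≤ t²` force `t² = 2r`, i.e. `t² - r = r`, where `β` vanishes? No:
  -- `β` may be nonzero at the endpoint; instead use the open bound: enlarge slightly.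
  -- From `h2 : t² ≤ 2r` and `h3 : 2r ≤ t²` we get `t² - r = r`, and `β(r) = 0` since `tsupport β ⊆ [-r, r]`
  -- does NOT exclude the endpoint; we argue via continuity-free support inclusion in the open ball instead:
  have ht2 : t ^ 2 - r = r := by linarith
  -- `β(r) = 0`: `β` is continuous and vanishes on `(r, ∞)`
  have hcw : Filter.Tendsto (adaptedBump n r) (𝓝[>] r) (𝓝 (adaptedBump n r r)) :=
    ((contDiff_adaptedBump n r (m := 0)).continuous.tendsto r).mono_left nhdsWithin_le_nhds
  have hzero : ∀ᶠ s in 𝓝[>] r, adaptedBump n r s = 0 := by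
    filter_upwards [self_mem_nhdsWithin] with s hs
    have hs : r < s := hs
    by_contra hne
    have hmem := tsupport_adaptedBump_subset n hr (subset_tsupport _ (Function.mem_support.2 hne))
    rw [mem_closedBall, dist_zero_right, Real.norm_eq_abs, abs_le] at hmem
    linarith [hmem.2]
  have h0 : adaptedBump n r r = 0 :=
    tendsto_nhds_unique hcw (tendsto_const_nhds.congr' (hzero.mono fun s hs => hs.symm))
  exact h (by rw [radialKernel, ht2, h0])

/-- **The real slices of the radial kernel are the slice functions**:
`β(|x + iy|² − r) = sliceFn n r (y² − r) x`. [folklore] -/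
theorem radialKernel_norm_mk (n : ℕ) (r x y : ℝ) : radialKernel n r ‖(⟨x, y⟩ : ℂ)‖ = sliceFn n r (y ^ 2 - r) x := by
  rw [radialKernel, sliceFn, Complex.sq_norm, Complex.normSq_mk]
  ring_nf

/-- **The mass of the radial kernel is `π`**: `∫_ℂ β(|w|² − r) dA = π` (`0 < r`). [folklore] -/
theorem integral_radialKernel_norm (n : ℕ) {r : ℝ} (hr : 0 < r) : ∫ w : ℂ, radialKernel n r ‖w‖ = π := by
  have hR : 0 < Real.sqrt (2 * r) := Real.sqrt_pos.2 (by positivity)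
  rw [Literature.Analysis.Complex.integral_radial_eq (continuous_radialKernel n r) hR (fun t ht => radialKernel_eq_zero n hr ht)]
  -- `∫_0^∞ t β(t² - r) dt = 1/2`: reduce to a finite interval and substitute `s = t² - r`
  set T : ℝ := Real.sqrt (2 * r) with hT
  have hvan : ∀ t, T ≤ t → t * radialKernel n r t * (2 * π) = 0 := fun t ht => by
    rw [radialKernel_eq_zero n hr ht]; ring
  have hIoi : ∫ t in Ioi (0 : ℝ), t * radialKernel n r t * (2 * π) = ∫ t in (0 : ℝ)..T, t * radialKernel n r t * (2 * π) := by
    rw [intervalIntegral.integral_of_le hR.le]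
    refine setIntegral_eq_of_subset_of_forall_sdiff_eq_zero measurableSet_Ioi Ioc_subset_Ioi_self
      fun t ht => ?_
    have ht' : T ≤ t := by
      rcases ht with ⟨h1, h2⟩
      by_contra hlt
      exact h2 ⟨h1, (lt_of_not_ge hlt).le⟩
    exact hvan t ht'
  rw [hIoi]
  -- substitution
  have hderiv : ∀ t ∈ uIcc (0 : ℝ) T, HasDerivAt (fun t : ℝ => t ^ 2 - r) (2 * t) t := fun t _ => by
    simpa using ((hasDerivAt_pow 2 t).sub_const r)
  have hcont : ContinuousOn (fun t : ℝ => 2 * t) (uIcc (0 : ℝ) T) := (continuous_const.mul continuous_id).continuousOn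
  have hsub := intervalIntegral.integral_comp_mul_deriv' (a := 0) (b := T) (f := fun t : ℝ => t ^ 2 - r) (f' := fun t => 2 * t)
    (g := adaptedBump n r) hderiv hcont (contDiff_adaptedBump n r (m := 0)).continuous.continuousOn
  have hfun : (fun t : ℝ => t * radialKernel n r t * (2 * π)) = fun t => π * (((adaptedBump n r) ∘ fun t : ℝ => t ^ 2 - r) t * (2 * t)) := by
    funext t; simp only [Function.comp, radialKernel]; ring
  rw [hfun, intervalIntegral.integral_const_mul, hsub]
  have h0 : (0 : ℝ) ^ 2 - r = -r := by ring
  have hT2 : T ^ 2 - r = r := by rw [hT, Real.sq_sqrt (by positivity)]; ring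
  rw [h0, hT2]
  -- `∫_{-r}^{r} β = ∫_ℝ β = 1`
  have hall : ∫ s in (-r)..r, adaptedBump n r s = ∫ s, adaptedBump n r s := by
    rw [intervalIntegral.integral_of_le (by linarith), ← integral_Icc_eq_integral_Ioc]
    refine setIntegral_eq_integral_of_forall_compl_eq_zero fun s hs => ?_
    by_contra hne
    have hmem := tsupport_adaptedBump_subset n hr (subset_tsupport _ (Function.mem_support.2 hne))
    rw [mem_closedBall, dist_zero_right, Real.norm_eq_abs, abs_le] at hmem
    exact hs ⟨hmem.1, hmem.2⟩
  rw [hall, integral_adaptedBump n hr, mul_one]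

end Literature.Analysis.Distribution
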